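/-
Copyright: the b2b-balaban T⁴-continuum CRUX team, row NE7b OWNER lineage `t4-ne7b-p1` (gen 135). Project licence.
-/
import Summits.QuantumFields.BalabanUV.T4Continuum.Spine.NE7b.SupFineCellSetActivity
import Summits.QuantumFields.BalabanUV.T4Continuum.Spine.NE7b.SupTwoLetterNextFactor

/-!
# THE FINE-CELL TWO-LETTER FORMAT CLOSES UNDER THE ROAD'S STEP — NESTING BY CONSTRUCTION: input singleton factors with
#   (S_fine) `‖f_X(ζ)‖ ≤ ε` when every FINE cell `c` of `X`'s cell is small (`Σ_cζ² ≤ h²`),   (L1) `‖1 + f_X(ζ)‖ ≤ e^{½κ₀Σ_{cells X}ζ²}`,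
# larger sets sup-small; the Gaussian road with the SMALL rate's global margin `2κ₀(1+τ)γ_op ≤ θ` and the conversion rate's LOCAL margin
# `2κ₂γ₂ ≤ θ` on sparse unions of fine cells; an external field `ψ` small on every fine cell of the singleton members (`Σ_cψ² ≤ Ψ²`, `Ψ ≤ h`) and on
# their cells (`Σ_{cells X}ψ² ≤ Ψ_P²`).  Then, with `ε_fine = ε + m·2e^{½κ₀(1+τ⁻¹)Ψ_P²}·e^{−½κ₂(h−Ψ)²}·A₁^v·A₂^{v₀}` and `η = #(⋃𝒜)(Δ+1)2e·ε₁`,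
# `ε₁ = 2e(Δ+1)²ε_fine`:
#   `‖Z_ψ(𝒜) − 1‖ ≤ 2η`   and, for the normalised factor,   `‖Z_ψ(𝒜)∕N_D − 1‖ ≤ 2η + (1 − N_D⁻¹)`   ((L1⁺) is (377)'s `nextTwoLetter_L1` verbatim),
# where the region of validity is «every CURRENT fine cell of every member small» — which IS a fine-cell region for the next scale with the next
# fine family `fine'(block) := ⋃_{members} fine`: the small-field regions NEST BY CONSTRUCTION, no smoothness letter, no `e^{κΨ²}` at a large
# rate, no inherited-rate doubling.  Also typed once for ANY format: **the small-field step from a SET ACTIVITY LETTER alone**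
# (`norm_pertZ_sub_one_le_of_setLetter`) — SCOPING-d7 (α2)+(α3) closed for one step with honest letters (row NE7b, node U5c; (380)∕(379)∕
# (377)∕(357)∕(355) BY NAME; [folklore])

Cell `pub-balaban`, sub-cell `t4`, spine estimate NE7b (`T4WeightBudget.RelWeightBound`; the cell's OWN estimate — NOT PRINTED in
[Bałaban 1983–89], NOT PROVED).  Crux-route work under `Spine/NE7b/` by the row OWNER (`t4-ne7b-p1` gen 135, file (381)) under FREEZE
(0)'s crux-prover clause, on this gen's SCOPING-d7 DECISION (1); NOTHING of Bałaban's is named as a Lean object, valued or asserted; no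
`T4Continuum/Support` leaf typed; no `def`, no notation; zero `sorry`.  Imports (BY NAME): the OWNER's (380) `…SupFineCellSetActivity`
(`fineCell_shift`, `norm_setActivity_le_fineCell`, `fineCell_integrable_prod`, `eps_fine_nonneg`), (377) `…SupTwoLetterNextFactor`
(`norm_le_two_mul_of_stability`, `one_le_normaliser`, `one_le_S₂`), (357) (`exp_setLogZ_linear`, `norm_setLogZ_le_linear`), (355)
(`cutoff_shifted_measurable_sets`), (296) (`pertZ_cutoff`), (289) (`one_le_regulatorCost`), the OWNER's `…SupGaussianFiniteRangeDependence`
(`gaussian_indep_of_not_touches`); Mathlib's `Complex.norm_exp_sub_one_le`.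

WHAT IS PROVED ([folklore]):
* §1 FOR ANY FORMAT: **`norm_pertZ_sub_one_le_of_setLetter`** (join-measurable set factors with integrable products, members of `𝒜` `R`-connected, a
  set activity letter `‖M(𝒜')‖ ≤ ∏εf^{#X}` with `0 < εf`, `e·ε₁·(Δ+1)² ≤ 1∕2`, `η ≤ 1∕2` ⟹ `‖Z(𝒜) − 1‖ ≤ 2η`);
* §2 THE FINE-CELL CUT-OFF LETTERS: `fineCell_cutoff_pt` (singletons: the (380) pointwise bound for the cut-off shifted factor with `M = 2e^{½κ₀(1+τ⁻¹)Ψ_P²}`,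
  `κ₁ = κ₀(1+τ)`, `r = h − Ψ`), `fineCell_cutoff_sup`;
* §3 THE END **`norm_pertZ_shifted_sub_one_le_fineCell`** (`‖Z_ψ(𝒜) − 1‖ ≤ 2η_fine`) and **`nextFineCell_S`** (the normalised factor's small letter
  on the per-fine-cell region); §4 toy.

HONEST (what this is NOT).  One step, honest letters.  What remains of NC-NE7b-α after this gen, LOCATED: (i) the local letter `γ₂` for the
lineage's shells on sparse unions ((378)'s Schur block test + (284)-type difference∕decay estimates); (ii) along the scales the SMALL stability rate
must fall like the inverse field operator norm (`κ₀,j·γ_op,j = O(1)` while `γ_op,j` grows): the step delivers `κ₀ ↦ κ₀(1+τ⁻¹)` — survival needs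
the QUADRATIC PART of the next potential extracted into the Gaussian (mass ∕ field-strength renormalisation), i.e. (α4) — together with the
extraction of the constant (vacuum energy, here the crude `N_D`) and the contraction of the remainder: the renormalisation group proper, untouched;
(iii) currency (α1) is a parameter of these files only informally (field sums `Σ_{cell}ω²`; the gradient version is (375)'s inputs + re-instantiation).
Scalar skeleton ((A3), NC-NE7b-α UNRULED); nothing of Bałaban's asserted.  BY-NAME EFFECT ON THE WALL: NONE.  NE7b NOT PRINTED ∕ NOT PROVED; spine
PROVED 0∕9; rung (B)+1 — the programme's measures remain FINITE-torus statements; NOT the mass gap, NOT Clay.  HONEST DEPENDENCY: continuum YM on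
T⁴ ⇐ BetaPertH ∧ nine spine estimates (0∕9 proved); BetaPertH ⇐ (D1) ∧ (D4) ∧ CAP+tail; G-an2-4 gates asym, D1 and NE2∕3∕4.
-/

set_option autoImplicit false

noncomputable section

namespace Summit.QuantumFields.BalabanUV.T4Continuum.NE7b.SupFineCellNextFactor

open MeasureTheory ProbabilityTheory Matrix Real Finset
open scoped BigOperators
open Literature.Probability.LatticeModels
open Literature.Analysis.Matrix (HasFiniteRange)
open SupFineCellSetActivity (fineCell_shift norm_setActivity_le_fineCell fineCell_integrable_prod eps_fine_nonneg)
open SupTwoLetterNextFactor (norm_le_two_mul_of_stability one_le_normaliser one_le_S₂)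
open SupPolymerLocalSmallnessLinear (exp_setLogZ_linear norm_setLogZ_le_linear)
open SupPolymerLocalStep (cutoff_shifted_measurable_sets)
open SupLocalisedPolymerGas (pertZ_cutoff)
open SupRegulatedActivityBound (one_le_regulatorCost)
open SupGaussianFiniteRangeDependence (gaussian_indep_of_not_touches)

variable {V : Type*} [DecidableEq V] {R : V → V → Prop} [DecidableRel R] {nbr : V → Finset V} {Δ : ℕ}
variable {ι : Type} [Fintype ι] [DecidableEq ι]

/-! ## §1. For any format: the small-field step from a set activity letter -/

/-- **THE SMALL-FIELD STEP FROM A SET ACTIVITY LETTER ALONE.**  `Γ ⪰ 0` of range `ρ` for `dι`; cells with `R` covering `ρ`-closeness, `R` symmetric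
with `≤ Δ` neighbours; set factors `g_X` join-measurable with integrable products; members of `𝒜` `R`-connected; a set activity letter
`‖M(𝒜')‖ ≤ ∏_{X∈𝒜'}εf^{#X}` for every family, `0 < εf`; `e·ε₁·(Δ+1)² ≤ 1∕2` (`ε₁ = 2e(Δ+1)²εf`) and `η := #(⋃𝒜)(Δ+1)2e·ε₁ ≤ 1∕2` ⟹
`‖Z(𝒜) − 1‖ ≤ 2η`. [folklore] -/
theorem norm_pertZ_sub_one_le_of_setLetter {Γ : Matrix ι ι ℝ} (hΓ : Γ.PosSemidef) {dι : ι → ι → ℕ} {ρ : ℕ}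
    (hfr : HasFiniteRange dι ρ Γ) (cell : V → Finset ι) (hRsymm : ∀ x y, R x y → R y x)
    (hR : ∀ (p p' : V) (x y : ι), x ∈ cell p → y ∈ cell p' → dι x y ≤ ρ → p = p' ∨ R p p')
    (hΔ : ∀ x, (nbr x).card ≤ Δ) (hnbr : ∀ x y, R x y → y ∈ nbr x) {g : Finset V → EuclideanSpace ℝ ι → ℂ}
    (𝒜 : Finset (Finset V)) (hconn : ∀ X ∈ 𝒜, IsRConnected R X)
    (hmeas : ∀ X, Measurable[⨆ p ∈ X, MeasurableSpace.comap (fun (ω : EuclideanSpace ℝ ι) (x : cell p) => ω x) inferInstance] (g X))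
    (hint : ∀ 𝒜' : Finset (Finset V), Integrable (fun ω => ∏ X ∈ 𝒜', g X ω) (multivariateGaussian (0 : EuclideanSpace ℝ ι) Γ))
    {εf : ℝ} (hεf : 0 < εf)
    (hM : ∀ 𝒜' : Finset (Finset V), ‖cellActivity (multivariateGaussian (0 : EuclideanSpace ℝ ι) Γ) g 𝒜'‖ ≤ ∏ X ∈ 𝒜', εf ^ X.card)
    (hsmall : Real.exp 1 * (2 * Real.exp 1 * ((Δ : ℝ) + 1) ^ 2 * εf) * ((Δ : ℝ) + 1) ^ 2 ≤ 1 / 2)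
    (hη : (𝒜.biUnion id).card * ((Δ : ℝ) + 1) * (2 * (Real.exp 1 * (2 * Real.exp 1 * ((Δ : ℝ) + 1) ^ 2 * εf))) ≤ 1 / 2) :
    ‖pertZ (multivariateGaussian (0 : EuclideanSpace ℝ ι) Γ) g 𝒜 - 1‖ ≤
      2 * ((𝒜.biUnion id).card * ((Δ : ℝ) + 1) * (2 * (Real.exp 1 * (2 * Real.exp 1 * ((Δ : ℝ) + 1) ^ 2 * εf)))) := by
  have hle : ∀ p, MeasurableSpace.comap (fun (ω : EuclideanSpace ℝ ι) (x : cell p) => ω x) inferInstance ≤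
      (inferInstance : MeasurableSpace (EuclideanSpace ℝ ι)) := fun _ => measurable_iff_comap_le.1 (by fun_prop)
  have hindep := fun K₁ K₂ hKK => gaussian_indep_of_not_touches hΓ (0 : EuclideanSpace ℝ ι) cell hfr hR K₁ K₂ hKK
  have hexp := exp_setLogZ_linear hRsymm hΔ hnbr hle hindep hmeas hint 𝒜 hconn hεf (fun 𝒜' _ => hM 𝒜') hsmall
  have hlog := norm_setLogZ_le_linear hRsymm hΔ hnbr 𝒜 hconn hεf (fun 𝒜' _ => hM 𝒜') hsmall
    (μ := multivariateGaussian (0 : EuclideanSpace ℝ ι) Γ) (f := g)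
  rw [← hexp]
  refine (Complex.norm_exp_sub_one_le (hlog.trans (hη.trans (by norm_num)))).trans ?_
  linarith

/-! ## §2. The fine-cell cut-off letters of the shifted factors -/

omit [DecidableRel R] [Fintype ι] in
/-- **Singletons: the cut-off shifted factor has (380)'s pointwise bound** with `M = 2e^{½κ₀(1+τ⁻¹)Ψ_P²}`, `κ₁ = κ₀(1+τ)`, `r = h − Ψ`
((L1) ⟹ (L) with `M₀ = 2`; then `fineCell_shift`). [folklore] -/
theorem fineCell_cutoff_pt (cell : V → Finset ι) (fine : V → Finset (Finset ι)) {f : Finset V → EuclideanSpace ℝ ι → ℂ}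
    {ε κ₀ τ h Ψ ΨP : ℝ} (hε : 0 ≤ ε) (hκ₀ : 0 ≤ κ₀) (hτ : 0 < τ) (𝒜 : Finset (Finset V))
    (hS : ∀ X ∈ 𝒜, X.card = 1 → ∀ ζ : EuclideanSpace ℝ ι, (∀ c ∈ X.biUnion fine, ∑ x ∈ c, ζ x ^ 2 ≤ h ^ 2) → ‖f X ζ‖ ≤ ε)
    (hL1 : ∀ X ∈ 𝒜, X.card = 1 → ∀ ζ : EuclideanSpace ℝ ι, ‖1 + f X ζ‖ ≤ exp (κ₀ * (∑ x ∈ X.biUnion cell, ζ x ^ 2) / 2))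
    (ψ : EuclideanSpace ℝ ι) (hΨ0 : 0 ≤ Ψ) (hΨh : Ψ ≤ h)
    (hψ : ∀ X ∈ 𝒜, X.card = 1 → ∀ c ∈ X.biUnion fine, ∑ x ∈ c, ψ x ^ 2 ≤ Ψ ^ 2)
    (hψP : ∀ X ∈ 𝒜, X.card = 1 → ∑ x ∈ X.biUnion cell, ψ x ^ 2 ≤ ΨP ^ 2) (X : Finset V) (hX1 : X.card = 1) (ω : EuclideanSpace ℝ ι) :
    ‖(if X ∈ 𝒜 then f X (ω + ψ) else 0)‖ ≤ ε + (if ∃ c ∈ X.biUnion fine, (h - Ψ) ^ 2 < ∑ x ∈ c, ω x ^ 2 then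
      (2 * exp (κ₀ * (1 + τ⁻¹) * ΨP ^ 2 / 2)) * exp (κ₀ * (1 + τ) * (∑ x ∈ X.biUnion cell, ω x ^ 2) / 2) else 0) := by
  by_cases hX : X ∈ 𝒜
  · simp only [hX, if_true]
    exact fineCell_shift (X.biUnion cell) (X.biUnion fine) hε zero_le_two hκ₀ hτ (hS X hX hX1)
      (fun ζ => norm_le_two_mul_of_stability (hL1 X hX hX1 ζ) (one_le_exp (by positivity))) ψ hΨ0 hΨh (hψ X hX hX1) (hψP X hX hX1) ω
  · simp only [hX, if_false, norm_zero]
    have : 0 ≤ (if ∃ c ∈ X.biUnion fine, (h - Ψ) ^ 2 < ∑ x ∈ c, ω x ^ 2 then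
        (2 * exp (κ₀ * (1 + τ⁻¹) * ΨP ^ 2 / 2)) * exp (κ₀ * (1 + τ) * (∑ x ∈ X.biUnion cell, ω x ^ 2) / 2) else 0) := by
      split_ifs <;> positivity
    linarith

omit [DecidableRel R] [Fintype ι] [DecidableEq ι] in
/-- Non-singletons: the cut-off shifted factor is sup-small with `ε^{#X}`. [folklore] -/
theorem fineCell_cutoff_sup {f : Finset V → EuclideanSpace ℝ ι → ℂ} {ε : ℝ} (hε : 0 ≤ ε) (𝒜 : Finset (Finset V))
    (hsup : ∀ X ∈ 𝒜, X.card ≠ 1 → ∀ ζ : EuclideanSpace ℝ ι, ‖f X ζ‖ ≤ ε ^ X.card) (ψ : EuclideanSpace ℝ ι) (X : Finset V) (hX1 : X.card ≠ 1)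
    (ω : EuclideanSpace ℝ ι) : ‖(if X ∈ 𝒜 then f X (ω + ψ) else 0)‖ ≤ ε ^ X.card := by
  split_ifs with hX
  · exact hsup X hX hX1 _
  · rw [norm_zero]; positivity

/-! ## §3. THE END: the fine-cell small letter of the next single-block factor -/

/-- **`‖Z_ψ(𝒜) − 1‖ ≤ 2η_fine` IN THE FINE-CELL FORMAT.**  `Γ ⪰ 0` of range `ρ`, `Γ ⪯ γ_op·1`, diagonal `≤ γ` (`γ ≥ 0`); disjoint cells of `≤ v` sites
with fine families (`⊆` cell, `≤ v₀` sites, `≤ m` each) and the local letter `γ₂` on sparse unions; `R` symmetric covering `ρ`-closeness with `≤ Δ`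
neighbours; members of `𝒜` `R`-connected, join-measurable, singletons with (S_fine) (`0 < ε`, radius `h`) and (L1) (rate `κ₀ ≥ 0`), the others
sup-small; `0 < τ`, `2κ₀(1+τ)γ_op ≤ θ`, `0 ≤ κ₂`, `2κ₂γ₂ ≤ θ`, `0 < θ < 1`; `ψ` with `Σ_cψ² ≤ Ψ²` on the members' fine cells (`0 ≤ Ψ ≤ h`) and
`Σ_{cells X}ψ² ≤ Ψ_P²` on their cells; smallness in `ε_fine` (displayed) ⟹ `‖Z_ψ(𝒜) − 1‖ ≤ 2η_fine`. [folklore] -/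
theorem norm_pertZ_shifted_sub_one_le_fineCell {Γ : Matrix ι ι ℝ} {γop γ₂ γ : ℝ} (hΓ : Γ.PosSemidef)
    (hΓop : (γop • (1 : Matrix ι ι ℝ) - Γ).PosSemidef) (hdiag : ∀ x, Γ x x ≤ γ) (hγ : 0 ≤ γ) {dι : ι → ι → ℕ} {ρ : ℕ}
    (hfr : HasFiniteRange dι ρ Γ) (cell : V → Finset ι) (hdisj : ∀ p q, p ≠ q → Disjoint (cell p) (cell q)) {v : ℕ}
    (hv : ∀ p, (cell p).card ≤ v) (fine : V → Finset (Finset ι)) (hfine : ∀ p, ∀ c ∈ fine p, c ⊆ cell p) {v₀ : ℕ}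
    (hv₀ : ∀ p, ∀ c ∈ fine p, c.card ≤ v₀) {m : ℕ} (hm : ∀ p, (fine p).card ≤ m)
    (hloc : ∀ (S : Finset V) (c : ∀ p ∈ S, Finset ι), (∀ p (hp : p ∈ S), c p hp ∈ fine p) →
      (γ₂ • (1 : Matrix (S.attach.biUnion fun p => c p.1 p.2) (S.attach.biUnion fun p => c p.1 p.2) ℝ) -
        Γ.submatrix (fun e : (S.attach.biUnion fun p => c p.1 p.2) => (e : ι))
          (fun e : (S.attach.biUnion fun p => c p.1 p.2) => (e : ι))).PosSemidef)
    (hRsymm : ∀ x y, R x y → R y x) (hR : ∀ (p p' : V) (x y : ι), x ∈ cell p → y ∈ cell p' → dι x y ≤ ρ → p = p' ∨ R p p')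
    (hΔ : ∀ x, (nbr x).card ≤ Δ) (hnbr : ∀ x y, R x y → y ∈ nbr x)
    {f : Finset V → EuclideanSpace ℝ ι → ℂ} {ε κ₀ κ₂ τ θ h Ψ ΨP : ℝ} (hε : 0 < ε) (hκ₀ : 0 ≤ κ₀) (hκ₂ : 0 ≤ κ₂) (hτ : 0 < τ)
    (hθ0 : 0 < θ) (hθ1 : θ < 1) (h1 : 2 * (κ₀ * (1 + τ)) * γop ≤ θ) (h2 : 2 * κ₂ * γ₂ ≤ θ)
    (𝒜 : Finset (Finset V)) (hconn : ∀ X ∈ 𝒜, IsRConnected R X)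
    (hmeas : ∀ X ∈ 𝒜, Measurable[⨆ p ∈ X, MeasurableSpace.comap (fun (ω : EuclideanSpace ℝ ι) (x : cell p) => ω x) inferInstance] (f X))
    (hS : ∀ X ∈ 𝒜, X.card = 1 → ∀ ζ : EuclideanSpace ℝ ι, (∀ c ∈ X.biUnion fine, ∑ x ∈ c, ζ x ^ 2 ≤ h ^ 2) → ‖f X ζ‖ ≤ ε)
    (hL1 : ∀ X ∈ 𝒜, X.card = 1 → ∀ ζ : EuclideanSpace ℝ ι, ‖1 + f X ζ‖ ≤ exp (κ₀ * (∑ x ∈ X.biUnion cell, ζ x ^ 2) / 2))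
    (hsup : ∀ X ∈ 𝒜, X.card ≠ 1 → ∀ ζ : EuclideanSpace ℝ ι, ‖f X ζ‖ ≤ ε ^ X.card) (ψ : EuclideanSpace ℝ ι) (hΨ0 : 0 ≤ Ψ) (hΨh : Ψ ≤ h)
    (hψ : ∀ X ∈ 𝒜, X.card = 1 → ∀ c ∈ X.biUnion fine, ∑ x ∈ c, ψ x ^ 2 ≤ Ψ ^ 2)
    (hψP : ∀ X ∈ 𝒜, X.card = 1 → ∑ x ∈ X.biUnion cell, ψ x ^ 2 ≤ ΨP ^ 2)
    (hsmall : Real.exp 1 * (2 * Real.exp 1 * ((Δ : ℝ) + 1) ^ 2 *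
      (ε + m * (2 * exp (κ₀ * (1 + τ⁻¹) * ΨP ^ 2 / 2)) * exp (-(κ₂ * (h - Ψ) ^ 2 / 2)) *
        (((1 - θ) ^ (-(2 * (κ₀ * (1 + τ)) * γ / (2 * θ)))) ^ v * ((1 - θ) ^ (-(2 * κ₂ * γ / (2 * θ)))) ^ v₀))) *
      ((Δ : ℝ) + 1) ^ 2 ≤ 1 / 2)
    (hη : (𝒜.biUnion id).card * ((Δ : ℝ) + 1) * (2 * (Real.exp 1 * (2 * Real.exp 1 * ((Δ : ℝ) + 1) ^ 2 *
      (ε + m * (2 * exp (κ₀ * (1 + τ⁻¹) * ΨP ^ 2 / 2)) * exp (-(κ₂ * (h - Ψ) ^ 2 / 2)) *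
        (((1 - θ) ^ (-(2 * (κ₀ * (1 + τ)) * γ / (2 * θ)))) ^ v * ((1 - θ) ^ (-(2 * κ₂ * γ / (2 * θ)))) ^ v₀))))) ≤ 1 / 2) :
    ‖pertZ (multivariateGaussian 0 Γ) (fun X ω => f X (ω + ψ)) 𝒜 - 1‖ ≤
      2 * ((𝒜.biUnion id).card * ((Δ : ℝ) + 1) * (2 * (Real.exp 1 * (2 * Real.exp 1 * ((Δ : ℝ) + 1) ^ 2 *
        (ε + m * (2 * exp (κ₀ * (1 + τ⁻¹) * ΨP ^ 2 / 2)) * exp (-(κ₂ * (h - Ψ) ^ 2 / 2)) *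
          (((1 - θ) ^ (-(2 * (κ₀ * (1 + τ)) * γ / (2 * θ)))) ^ v * ((1 - θ) ^ (-(2 * κ₂ * γ / (2 * θ)))) ^ v₀)))))) := by
  have hκ₁ : 0 ≤ κ₀ * (1 + τ) := by positivity
  have hκθ : κ₀ * (1 + τ) * γop ≤ θ := by
    rcases le_or_gt 0 (κ₀ * (1 + τ) * γop) with h | h <;> linarith
  have hM : (0 : ℝ) ≤ 2 * exp (κ₀ * (1 + τ⁻¹) * ΨP ^ 2 / 2) := by positivity
  have hεf : 0 < ε + m * (2 * exp (κ₀ * (1 + τ⁻¹) * ΨP ^ 2 / 2)) * exp (-(κ₂ * (h - Ψ) ^ 2 / 2)) *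
      (((1 - θ) ^ (-(2 * (κ₀ * (1 + τ)) * γ / (2 * θ)))) ^ v * ((1 - θ) ^ (-(2 * κ₂ * γ / (2 * θ)))) ^ v₀) :=
    lt_of_lt_of_le hε (le_add_of_nonneg_right (by
      have hA₁ : 0 ≤ ((1 - θ) ^ (-(2 * (κ₀ * (1 + τ)) * γ / (2 * θ)))) ^ v :=
        pow_nonneg (zero_le_one.trans (one_le_regulatorCost (by positivity) hθ0 hθ1)) _
      have hA₂ : 0 ≤ ((1 - θ) ^ (-(2 * κ₂ * γ / (2 * θ)))) ^ v₀ :=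
        pow_nonneg (zero_le_one.trans (one_le_regulatorCost (by positivity) hθ0 hθ1)) _
      positivity))
  -- the cut-off shifted factors and their fine-cell letters
  have hmeas' := cutoff_shifted_measurable_sets cell 𝒜 hmeas ψ
  have hpt' := fun X (hX1 : X.card = 1) ω => fineCell_cutoff_pt cell fine hε.le hκ₀ hτ 𝒜 hS hL1 ψ hΨ0 hΨh hψ hψP X hX1 ω
  have hsup' := fun X (hX1 : X.card ≠ 1) ω => fineCell_cutoff_sup hε.le 𝒜 hsup ψ X hX1 ω
  have hint' := fineCell_integrable_prod hΓ hΓop cell hdisj fine hε.le hM hκ₁ hθ1 hκθ hmeas' hpt' hsup'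
  have hM' := norm_setActivity_le_fineCell hΓ hΓop hdiag hγ cell hdisj hv fine hfine hv₀ hm hloc hε.le hM hκ₁ hκ₂ hθ0 hθ1 h1 h2 hmeas' hpt'
    hsup'
  have h := norm_pertZ_sub_one_le_of_setLetter hΓ hfr cell hRsymm hR hΔ hnbr 𝒜 hconn hmeas' hint' hεf hM' hsmall hη
  rwa [pertZ_cutoff] at h

/-- **(S_fine⁺) THE NORMALISED NEXT FACTOR IS SMALL ON THE PER-FINE-CELL REGION**: under the hypotheses of
`norm_pertZ_shifted_sub_one_le_fineCell` with the members inside `D` and (377)'s normaliser `N_D = S₂·A₀^{#cells D}` (`A₀` at rate `κ₀(1+τ)`, margin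
`θ₀`): `‖Z_ψ(𝒜)∕N_D − 1‖ ≤ 2η_fine + (1 − N_D⁻¹)`.  The region «every fine cell of every member small, every member's cell small» is a fine-cell
region for the block with the next fine family `⋃_{members}fine` — nesting by construction. [folklore] -/
theorem nextFineCell_S {Γ : Matrix ι ι ℝ} {γop γ₂ γ : ℝ} (hΓ : Γ.PosSemidef)
    (hΓop : (γop • (1 : Matrix ι ι ℝ) - Γ).PosSemidef) (hdiag : ∀ x, Γ x x ≤ γ) (hγ : 0 ≤ γ) {dι : ι → ι → ℕ} {ρ : ℕ}
    (hfr : HasFiniteRange dι ρ Γ) (cell : V → Finset ι) (hdisj : ∀ p q, p ≠ q → Disjoint (cell p) (cell q)) {v : ℕ}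
    (hv : ∀ p, (cell p).card ≤ v) (fine : V → Finset (Finset ι)) (hfine : ∀ p, ∀ c ∈ fine p, c ⊆ cell p) {v₀ : ℕ}
    (hv₀ : ∀ p, ∀ c ∈ fine p, c.card ≤ v₀) {m : ℕ} (hm : ∀ p, (fine p).card ≤ m)
    (hloc : ∀ (S : Finset V) (c : ∀ p ∈ S, Finset ι), (∀ p (hp : p ∈ S), c p hp ∈ fine p) →
      (γ₂ • (1 : Matrix (S.attach.biUnion fun p => c p.1 p.2) (S.attach.biUnion fun p => c p.1 p.2) ℝ) -
        Γ.submatrix (fun e : (S.attach.biUnion fun p => c p.1 p.2) => (e : ι))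
          (fun e : (S.attach.biUnion fun p => c p.1 p.2) => (e : ι))).PosSemidef)
    (hRsymm : ∀ x y, R x y → R y x) (hR : ∀ (p p' : V) (x y : ι), x ∈ cell p → y ∈ cell p' → dι x y ≤ ρ → p = p' ∨ R p p')
    (hΔ : ∀ x, (nbr x).card ≤ Δ) (hnbr : ∀ x y, R x y → y ∈ nbr x)
    {f : Finset V → EuclideanSpace ℝ ι → ℂ} {ε κ₀ κ₂ τ θ θ₀ h Ψ ΨP : ℝ} (hε : 0 < ε) (hκ₀ : 0 ≤ κ₀) (hκ₂ : 0 ≤ κ₂) (hτ : 0 < τ)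
    (hθ0 : 0 < θ) (hθ1 : θ < 1) (h1 : 2 * (κ₀ * (1 + τ)) * γop ≤ θ) (h2 : 2 * κ₂ * γ₂ ≤ θ) (hθ₀0 : 0 < θ₀) (hθ₀1 : θ₀ < 1)
    (𝒜 : Finset (Finset V)) (hconn : ∀ X ∈ 𝒜, IsRConnected R X) (D : Finset V)
    (hmeas : ∀ X ∈ 𝒜, Measurable[⨆ p ∈ X, MeasurableSpace.comap (fun (ω : EuclideanSpace ℝ ι) (x : cell p) => ω x) inferInstance] (f X))
    (hS : ∀ X ∈ 𝒜, X.card = 1 → ∀ ζ : EuclideanSpace ℝ ι, (∀ c ∈ X.biUnion fine, ∑ x ∈ c, ζ x ^ 2 ≤ h ^ 2) → ‖f X ζ‖ ≤ ε)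
    (hL1 : ∀ X ∈ 𝒜, X.card = 1 → ∀ ζ : EuclideanSpace ℝ ι, ‖1 + f X ζ‖ ≤ exp (κ₀ * (∑ x ∈ X.biUnion cell, ζ x ^ 2) / 2))
    (hsup : ∀ X ∈ 𝒜, X.card ≠ 1 → ∀ ζ : EuclideanSpace ℝ ι, ‖f X ζ‖ ≤ ε ^ X.card) (ψ : EuclideanSpace ℝ ι) (hΨ0 : 0 ≤ Ψ) (hΨh : Ψ ≤ h)
    (hψ : ∀ X ∈ 𝒜, X.card = 1 → ∀ c ∈ X.biUnion fine, ∑ x ∈ c, ψ x ^ 2 ≤ Ψ ^ 2)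
    (hψP : ∀ X ∈ 𝒜, X.card = 1 → ∑ x ∈ X.biUnion cell, ψ x ^ 2 ≤ ΨP ^ 2)
    (hsmall : Real.exp 1 * (2 * Real.exp 1 * ((Δ : ℝ) + 1) ^ 2 *
      (ε + m * (2 * exp (κ₀ * (1 + τ⁻¹) * ΨP ^ 2 / 2)) * exp (-(κ₂ * (h - Ψ) ^ 2 / 2)) *
        (((1 - θ) ^ (-(2 * (κ₀ * (1 + τ)) * γ / (2 * θ)))) ^ v * ((1 - θ) ^ (-(2 * κ₂ * γ / (2 * θ)))) ^ v₀))) *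
      ((Δ : ℝ) + 1) ^ 2 ≤ 1 / 2)
    (hη : (𝒜.biUnion id).card * ((Δ : ℝ) + 1) * (2 * (Real.exp 1 * (2 * Real.exp 1 * ((Δ : ℝ) + 1) ^ 2 *
      (ε + m * (2 * exp (κ₀ * (1 + τ⁻¹) * ΨP ^ 2 / 2)) * exp (-(κ₂ * (h - Ψ) ^ 2 / 2)) *
        (((1 - θ) ^ (-(2 * (κ₀ * (1 + τ)) * γ / (2 * θ)))) ^ v * ((1 - θ) ^ (-(2 * κ₂ * γ / (2 * θ)))) ^ v₀))))) ≤ 1 / 2) :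
    ‖pertZ (multivariateGaussian 0 Γ) (fun X ω => f X (ω + ψ)) 𝒜 /
          (((∏ X ∈ 𝒜 with ¬ X.card = 1, ((1 : ℝ) + ε ^ X.card)) *
            ((1 - θ₀) ^ (-(κ₀ * (1 + τ) * γ / (2 * θ₀)))) ^ (D.biUnion cell).card : ℝ) : ℂ) - 1‖ ≤
      2 * ((𝒜.biUnion id).card * ((Δ : ℝ) + 1) * (2 * (Real.exp 1 * (2 * Real.exp 1 * ((Δ : ℝ) + 1) ^ 2 *
        (ε + m * (2 * exp (κ₀ * (1 + τ⁻¹) * ΨP ^ 2 / 2)) * exp (-(κ₂ * (h - Ψ) ^ 2 / 2)) *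
          (((1 - θ) ^ (-(2 * (κ₀ * (1 + τ)) * γ / (2 * θ)))) ^ v * ((1 - θ) ^ (-(2 * κ₂ * γ / (2 * θ)))) ^ v₀)))))) +
      (1 - ((∏ X ∈ 𝒜 with ¬ X.card = 1, ((1 : ℝ) + ε ^ X.card)) *
            ((1 - θ₀) ^ (-(κ₀ * (1 + τ) * γ / (2 * θ₀)))) ^ (D.biUnion cell).card)⁻¹) := by
  set Z := pertZ (multivariateGaussian 0 Γ) (fun X ω => f X (ω + ψ)) 𝒜 with hZ
  set N : ℝ := (∏ X ∈ 𝒜 with ¬ X.card = 1, ((1 : ℝ) + ε ^ X.card)) *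
    ((1 - θ₀) ^ (-(κ₀ * (1 + τ) * γ / (2 * θ₀)))) ^ (D.biUnion cell).card with hN
  have hsmallZ := norm_pertZ_shifted_sub_one_le_fineCell hΓ hΓop hdiag hγ hfr cell hdisj hv fine hfine hv₀ hm hloc hRsymm hR hΔ hnbr hε hκ₀
    hκ₂ hτ hθ0 hθ1 h1 h2 𝒜 hconn hmeas hS hL1 hsup ψ hΨ0 hΨh hψ hψP hsmall hη
  rw [← hZ] at hsmallZ
  set η2 : ℝ := 2 * ((𝒜.biUnion id).card * ((Δ : ℝ) + 1) * (2 * (Real.exp 1 * (2 * Real.exp 1 * ((Δ : ℝ) + 1) ^ 2 *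
    (ε + m * (2 * exp (κ₀ * (1 + τ⁻¹) * ΨP ^ 2 / 2)) * exp (-(κ₂ * (h - Ψ) ^ 2 / 2)) *
      (((1 - θ) ^ (-(2 * (κ₀ * (1 + τ)) * γ / (2 * θ)))) ^ v * ((1 - θ) ^ (-(2 * κ₂ * γ / (2 * θ)))) ^ v₀)))))) with hη2
  have hκγ : 0 ≤ κ₀ * (1 + τ) * γ := by positivity
  have hN1 : 1 ≤ N := one_le_normaliser (one_le_S₂ hε.le 𝒜) (one_le_regulatorCost hκγ hθ₀0 hθ₀1)
  have hN0 : 0 < N := lt_of_lt_of_le one_pos hN1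
  have hη2_0 : 0 ≤ η2 := le_trans (norm_nonneg _) hsmallZ
  have hNc0 : (N : ℂ) ≠ 0 := by exact_mod_cast hN0.ne'
  have hsplit : Z / (N : ℂ) - 1 = (Z - 1) / (N : ℂ) + ((1 : ℂ) / (N : ℂ) - 1) := by
    field_simp
    ring
  rw [hsplit]
  have hNc : ‖(N : ℂ)‖ = N := by rw [Complex.norm_real, Real.norm_eq_abs, abs_of_pos hN0]
  have h1' : ‖(Z - 1) / (N : ℂ)‖ ≤ η2 := by
    rw [norm_div, hNc, div_le_iff₀ hN0]
    exact hsmallZ.trans (le_mul_of_one_le_right hη2_0 hN1)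
  have h2' : ‖(1 : ℂ) / (N : ℂ) - 1‖ = 1 - N⁻¹ := by
    have h3 : (1 : ℂ) / (N : ℂ) - 1 = (((1 / N - 1 : ℝ)) : ℂ) := by push_cast; ring
    rw [h3, Complex.norm_real, Real.norm_eq_abs, abs_of_nonpos (by rw [one_div]; linarith [inv_le_one_of_one_le₀ hN1]), one_div]
    ring
  calc ‖(Z - 1) / (N : ℂ) + ((1 : ℂ) / (N : ℂ) - 1)‖ ≤ ‖(Z - 1) / (N : ℂ)‖ + ‖(1 : ℂ) / (N : ℂ) - 1‖ := norm_add_le _ _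
    _ ≤ η2 + (1 - N⁻¹) := add_le_add h1' h2'.le

/-! ## §4. Toy -/

omit [DecidableRel R] [Fintype ι] [DecidableEq ι] in
/-- Toy (§2): the cut-off of a set OUTSIDE the family is the zero factor, sup-small with any `ε ≥ 0`. -/
example {f : Finset V → EuclideanSpace ℝ ι → ℂ} {ε : ℝ} (hε : 0 ≤ ε) (ψ ω : EuclideanSpace ℝ ι) (X : Finset V) (hX1 : X.card ≠ 1) :
    ‖(if X ∈ (∅ : Finset (Finset V)) then f X (ω + ψ) else 0)‖ ≤ ε ^ X.card :=
  fineCell_cutoff_sup hε ∅ (fun _ h => absurd h (Finset.notMem_empty _)) ψ X hX1 ω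

end Summit.QuantumFields.BalabanUV.T4Continuum.NE7b.SupFineCellNextFactor
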